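import Literature.AlgebraicGeometry.Frobenioids.NumberFieldLocalizationCategories
import Literature.AlgebraicGeometry.Frobenioids.BCatOrbits
import Mathlib.GroupTheory.SpecificGroups.Alternating
import HarnessLib

/-!
# Frobenioids II, Example 1.4 (ii): the printed `Aut`-bijection fails for `(G, D) = (S₃, A₃)`

Mochizuki, *The geometry of Frobenioids II*, Kyushu J. Math. **62** (2008) 401–460, §1 Example 1.4
(ii), author's text p. 13 [cite: MochizukiFrdII2008, Ex. 1.4 (ii) p.13]: "if `E₀ ∈ Ob(E₀)` projects to
`P₀ ∈ Ob(P₀)`, then `E₀ → P₀` induces a bijection `Aut_{E₀}(E₀) ⥲ Aut_{P₀}(P₀)`".  The statement file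
`NumberFieldLocalizationCategories.lean` (seat abc-iut-L1-t8) types this AS PRINTED as the named statement
`NFLocCat.AutBijective G D` and records in its docstring the CAVEAT that surjectivity fails for
`(G, D) ≅ (S₃, A₃)` (arithmetically: `F̃ = ℚ(∛2, ζ₃)/ℚ`, `v = 7`).  This PROOF-ONLY file kernel-checks
that caveat: for `G = S₃` (discrete, hence profinite) and `D = A₃`, the object `(P, Q, id)` with
`Q = {0,1,2}` (natural `S₃`-action, `Aut_{Q₀}(Q) = 1`) and `P = Q|_{A₃}` (`Aut_{P₀}(P) ≅ ℤ/3`) has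
`Aut_{E₀} = 1`, so the map to `Aut_{P₀}(P) ∋` (rotation) is not surjective:
`not_autBijective_perm_fin_three`, whence `exists_profinite_not_autBijective`.  The injectivity half holds
in general (`NFLocCat.autBijective_injective`, file `NumberFieldLocalizationCategoriesProofs.lean`).
No side is taken on how the printed sentence should be read; the typing seat and the layer lead own the
repair of the named statement.
-/

namespace Literature.AlgebraicGeometry.Frobenioids

namespace NFLocCat

open CategoryTheory CategoryTheory.Limits
open scoped FintypeCatDiscrete

/-- For `G = S₃` with the discrete topology and `D = A₃`, the typed statement `AutBijective G D` is
false: the rotation of `P = {0,1,2}|_{A₃}` does not lift to an automorphism of `(P, {0,1,2}, id)` in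
`E₀`. [cite: MochizukiFrdII2008, Ex. 1.4 (ii) p.13] -/
theorem not_autBijective_perm_fin_three :
    ¬ @AutBijective (Equiv.Perm (Fin 3)) _ ⊥ (alternatingGroup (Fin 3)) := by
  letI : TopologicalSpace (Equiv.Perm (Fin 3)) := ⊥
  haveI : DiscreteTopology (Equiv.Perm (Fin 3)) := ⟨rfl⟩
  haveI : IsTopologicalGroup (Equiv.Perm (Fin 3)) :=
    { continuous_mul := continuous_of_discreteTopology
      continuous_inv := continuous_of_discreteTopology }
  intro hbij
  -- notation
  let G := Equiv.Perm (Fin 3)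
  let D : Subgroup G := alternatingGroup (Fin 3)
  let c : G := finRotate 3
  have hc : c ∈ D := by
    change Equiv.Perm.sign (finRotate (2 + 1)) = 1
    rw [sign_finRotate]
    norm_num
  have hcomm' : ∀ σ : Equiv.Perm (Fin 3), Equiv.Perm.sign σ = 1 → σ * finRotate 3 = finRotate 3 * σ := by
    decide
  have hcomm : ∀ d : D, (d : G) * c = c * (d : G) := fun d =>
    hcomm' d.1 (Equiv.Perm.mem_alternatingGroup.mp d.2)
  -- the `S₃`-set `{0,1,2}`
  let QA : Action FintypeCat.{0} G := Action.FintypeCat.ofMulAction G (FintypeCat.of (Fin 3))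
  have hQA : Action.IsContinuous QA := (BCat.isContinuous_iff QA).mpr fun _ => isOpen_discrete _
  let Q : BCat G := ⟨QA, hQA⟩
  let q0 : Q.obj.V := (0 : Fin 3)
  have smulQ : ∀ (σ : G) (x : Fin 3), σ • (show Q.obj.V from x) = (σ : Equiv.Perm (Fin 3)) x :=
    fun _ _ => rfl
  have hQ : IsConnectedObj Q := BCat.isConnectedObj_of_transitive Q q0 fun y =>
    ⟨Equiv.swap (0 : Fin 3) y, by
      rw [smulQ]
      exact Equiv.swap_apply_left (0 : Fin 3) y⟩
  -- its restriction to `A₃`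
  let P : BCat D := (res G D).obj Q
  let p0 : P.obj.V := (0 : Fin 3)
  have smulP : ∀ (d : D) (x : Fin 3), d • (show P.obj.V from x) = ((d : G) : Equiv.Perm (Fin 3)) x :=
    fun _ _ => rfl
  have hP : IsConnectedObj P := BCat.isConnectedObj_of_transitive P p0 fun y => by
    have hrot : ∀ z : Fin 3, ∃ k : ℕ, k < 3 ∧ ((finRotate 3) ^ k) 0 = z := by decide
    obtain ⟨k, -, hk⟩ := hrot y
    exact ⟨⟨c ^ k, D.pow_mem hc k⟩, by rw [smulP]; exact hk⟩
  let T : ECat G D := ⟨⟨⟨P, hP⟩, ⟨Q, hQ⟩, 𝟙 P⟩, show Mono (𝟙 P) from inferInstance⟩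
  -- the rotation, an automorphism of `P` in `P₀ = B(A₃)⁰`
  let r : P ⟶ P := ObjectProperty.homMk
    { hom := FintypeCat.homMk fun x : Fin 3 => c x
      comm := fun d => FintypeCat.hom_ext _ _ fun x => by
        change c (((d : G) : Equiv.Perm (Fin 3)) x) = ((d : G) : Equiv.Perm (Fin 3)) (c x)
        rw [← Equiv.Perm.mul_apply, ← Equiv.Perm.mul_apply, hcomm d] }
  have hriso : IsIso r := BCat.isIso_of_bijective r (show Function.Bijective fun x : Fin 3 => c x from
    c.bijective)
  let rIso : (⟨P, hP⟩ : PCat G D) ≅ ⟨P, hP⟩ := (connectedObjects (BCat D)).isoMk (@asIso _ _ _ _ r hriso)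
  -- a lift `α` of the rotation to `Aut_{E₀}(T)`
  obtain ⟨α, hα⟩ := (hbij T).2 rIso
  have hleft : α.hom.hom.left = ObjectProperty.homMk r := congrArg Iso.hom hα
  -- its `Q`-component `b` is `S₃`-equivariant, hence fixes `0` (the only fixed point of `(1 2)`)
  have hb0 : α.hom.hom.right.hom.hom.hom q0 = q0 := by
    have e := BCat.hom_smul α.hom.hom.right.hom (Equiv.swap (1 : Fin 3) 2) q0
    have h0' : Equiv.swap (1 : Fin 3) 2 0 = 0 := by decide
    have h0 : Equiv.swap (1 : Fin 3) 2 • q0 = q0 := by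
      rw [smulQ]
      exact h0'
    rw [h0] at e
    -- `e : b 0 = (1 2) • b 0`
    have key : ∀ z : Fin 3, z = Equiv.swap (1 : Fin 3) 2 z → z = 0 := by decide
    exact key _ (e.trans (smulQ _ _))
  -- compatibility with `ι = id`: the `P`-component agrees with the `Q`-component on points
  have hw := congrArg (fun k => k.hom.hom p0) α.hom.hom.w
  have ha0 : α.hom.hom.left.hom.hom.hom p0 = p0 := hw.trans hb0
  rw [hleft] at ha0
  have : c 0 = 0 := ha0
  exact absurd this (by decide)

/-- Hence the schema `AutBijective` is not valid over all profinite pairs `(G, D)`: it fails for the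
(finite, discrete) pair `(S₃, A₃)`. [cite: MochizukiFrdII2008, Ex. 1.4 (ii) p.13] -/
theorem exists_profinite_not_autBijective :
    ∃ (G : Type) (_ : Group G) (_ : TopologicalSpace G) (_ : IsTopologicalGroup G) (_ : CompactSpace G)
      (_ : TotallyDisconnectedSpace G) (D : Subgroup G), ¬ AutBijective G D := by
  letI : TopologicalSpace (Equiv.Perm (Fin 3)) := ⊥
  haveI : DiscreteTopology (Equiv.Perm (Fin 3)) := ⟨rfl⟩
  haveI : IsTopologicalGroup (Equiv.Perm (Fin 3)) :=
    { continuous_mul := continuous_of_discreteTopology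
      continuous_inv := continuous_of_discreteTopology }
  exact ⟨Equiv.Perm (Fin 3), inferInstance, ⊥, inferInstance, inferInstance, inferInstance,
    alternatingGroup (Fin 3), not_autBijective_perm_fin_three⟩

end NFLocCat

end Literature.AlgebraicGeometry.Frobenioids
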